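import Mathlib
import Summits.Ventures.PercRepro2.HCov
import Summits.Ventures.PercRepro2.RootLeafUSigns
import Summits.Ventures.PercRepro2.RootLeafUSecond
import Summits.Ventures.PercRepro2.RootLeafUHalf
import Summits.Ventures.PercRepro2.RootLeafUMixK

/-!
# (MIX-K) from abstract shares: the `o ∈ K` half `0 ≤ T2oK` whenever `b`'s cluster membership on `Q`
is an independent share (blind cell PercRepro2, p4 g16; S3 (G4-u) item (ac); no definitions)

The coin-class argument of RootLeafUCoinK uses the two coins only through the SHARES
`N·P(Z, b ∈ K) = ρ_K·P(Z)`, `N·P(Z, b ∈ L) = ρ_L·P(Z)` on the events `Z ∈ {PD, T, T′}` and their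
`{o ∈ K}`-sections, and through `N = 0 ⟹ P₀ = 0`.  Here the argument is stated with `N, ρ_K, ρ_L` as
abstract numbers and the shares as hypotheses:

* **`N_Xb_eq`**: `N·X_b = −ρ_K·ℋ′` (the mixed term collapses onto the BHK slack);
* **`NA_sub_eq`**: `N·A − 2β·ρ_K = 2Λ`, `Λ = P₀·(N·hb − ρ_K) + ρ_L·(P₀ − d0·Z)`;
* **`Lam_nonneg`**: `0 ≤ Λ` — `N·hb − ρ_K ≥ 0` is HARRIS (`P(Q, b ∈ K) ≤ P(Q)·hb`, `Q` decreasing,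
  `{b ∈ K}` increasing) combined with the share on `Q` itself, and `P₀ − d0·Z ≥ 0` is Harris again;
* **`mixK_of_shares`**, **`T2oK_nonneg_of_shares`**: (MIX-K), hence `0 ≤ T2oK`.

The coin class is the instance `N = 1 − p₁p₂`, `ρ_K = p₁(1 − p₂)`, `ρ_L = (1 − p₁)p₂`; the root-only
pocket at `b` (RootLeafUPocketShare) is the instance `N = P(Qinn)`, `ρ_K = P(Kinn)`, `ρ_L = P(Linn)`.
-/

namespace Summit.Ventures.PercRepro2

open UnionCluster CovForm

namespace RootLeafU

namespace Share

variable {V : Type*} {E : Type*} [Fintype E] [DecidableEq E] [Fintype V] [DecidableEq V]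
  {R : Type*} [Field R] [LinearOrder R] [IsStrictOrderedRing R]

section KSide

variable (p : E → R) (ends : E → Sym2 V) (o a₂ c b u : V) (N ρK ρL : R)

omit [Fintype V] [DecidableEq V] [LinearOrder R] [IsStrictOrderedRing R] in
/-- **The mixed term collapses**: `N·X_b = −ρ_K·ℋ′` from the shares on `T′`, `T′ ∩ oK`, `PD ∩ oK`, `PD`. -/
theorem N_Xb_eq
    (s1 : N * prob p (TEvent ends a₂ u c ∩ (connEvent ends a₂ o ∩ connEvent ends a₂ b)) = ρK * prob p (TEvent ends a₂ u c ∩ connEvent ends a₂ o))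
    (s2 : N * prob p (TEvent ends a₂ u c ∩ connEvent ends a₂ b) = ρK * prob p (TEvent ends a₂ u c))
    (s3 : N * prob p (PDEvent ends u a₂ c ∩ (connEvent ends a₂ o ∩ connEvent ends u b)) = ρL * prob p (PDEvent ends u a₂ c ∩ connEvent ends a₂ o))
    (s4 : N * prob p (TEvent ends a₂ u c ∩ (connEvent ends a₂ o ∩ connEvent ends u b)) = ρL * prob p (TEvent ends a₂ u c ∩ connEvent ends a₂ o))
    (s5 : N * prob p (PDEvent ends u a₂ c ∩ connEvent ends u b) = ρL * prob p (PDEvent ends u a₂ c))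
    (s6 : N * prob p (TEvent ends a₂ u c ∩ connEvent ends u b) = ρL * prob p (TEvent ends a₂ u c)) :
    N * (prob p (TEvent ends a₂ u c ∩ (connEvent ends a₂ o ∩ connEvent ends a₂ b)) * (prob p (PDEvent ends u a₂ c) + prob p (TEvent ends a₂ u c)) - prob p (TEvent ends a₂ u c ∩ connEvent ends a₂ b) * (prob p (PDEvent ends u a₂ c ∩ connEvent ends a₂ o) + prob p (TEvent ends a₂ u c ∩ connEvent ends a₂ o)) - (prob p (PDEvent ends u a₂ c ∩ (connEvent ends a₂ o ∩ connEvent ends u b)) + prob p (TEvent ends a₂ u c ∩ (connEvent ends a₂ o ∩ connEvent ends u b))) * (prob p (PDEvent ends u a₂ c) + prob p (TEvent ends a₂ u c)) + (prob p (PDEvent ends u a₂ c ∩ connEvent ends u b) + prob p (TEvent ends a₂ u c ∩ connEvent ends u b)) * (prob p (PDEvent ends u a₂ c ∩ connEvent ends a₂ o) + prob p (TEvent ends a₂ u c ∩ connEvent ends a₂ o))) =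
      -ρK * (prob p (TEvent ends a₂ u c) * prob p (PDEvent ends u a₂ c ∩ connEvent ends a₂ o) - prob p (PDEvent ends u a₂ c) * prob p (TEvent ends a₂ u c ∩ connEvent ends a₂ o)) := by
  linear_combination (prob p (PDEvent ends u a₂ c) + prob p (TEvent ends a₂ u c)) * s1 - (prob p (PDEvent ends u a₂ c ∩ connEvent ends a₂ o) + prob p (TEvent ends a₂ u c ∩ connEvent ends a₂ o)) * s2 - (prob p (PDEvent ends u a₂ c) + prob p (TEvent ends a₂ u c)) * (s3 + s4) + (prob p (PDEvent ends u a₂ c ∩ connEvent ends a₂ o) + prob p (TEvent ends a₂ u c ∩ connEvent ends a₂ o)) * (s5 + s6)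

omit [Fintype V] in
/-- **The constant collapses**: `N·A − 2β·ρ_K = 2Λ`, `Λ = P₀·(N·hb − ρ_K) + ρ_L·(P₀ − d0·Z)`, from the
shares on `PD`, `T`, `T′`. -/
theorem NA_sub_eq
    (s2 : N * prob p (TEvent ends a₂ u c ∩ connEvent ends a₂ b) = ρK * prob p (TEvent ends a₂ u c))
    (s5 : N * prob p (PDEvent ends u a₂ c ∩ connEvent ends u b) = ρL * prob p (PDEvent ends u a₂ c))
    (s6 : N * prob p (TEvent ends a₂ u c ∩ connEvent ends u b) = ρL * prob p (TEvent ends a₂ u c))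
    (s7 : N * prob p (TEvent ends u a₂ c ∩ connEvent ends a₂ b) = ρK * prob p (TEvent ends u a₂ c))
    (s8 : N * prob p (TEvent ends u a₂ c ∩ connEvent ends u b) = ρL * prob p (TEvent ends u a₂ c))
    (s9 : N * prob p (PDEvent ends u a₂ c ∩ connEvent ends a₂ b) = ρK * prob p (PDEvent ends u a₂ c)) :
    N * ((prob p (PDEvent ends u a₂ c) * prob p (connEvent ends a₂ b) + prob p (avoidAll ends a₂ {c}) * gap p ends u a₂ b) + (prob p Set.univ * EQb3 p ends u a₂ c b + prob p Set.univ * PDb p ends u a₂ c b + prob p (connEvent ends a₂ b) * EQ3 p ends u a₂ c + prob p (connEvent ends a₂ b) * prob p (avoidAll ends a₂ {u}) - (prob p Set.univ - prob p (avoidAll ends a₂ {c})) * gap p ends u a₂ b)) -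
      2 * (prob p Set.univ * prob p (PDEvent ends u a₂ c) + prob p (avoidAll ends a₂ {c}) * prob p (avoidAll ends a₂ {u})) * ρK =
    2 * ((prob p (PDEvent ends u a₂ c) + prob p (TEvent ends a₂ u c)) * (N * prob p (connEvent ends a₂ b) - ρK) + ρL * ((prob p (PDEvent ends u a₂ c) + prob p (TEvent ends a₂ u c)) - prob p (avoidAll ends a₂ {c}) * prob p (avoidAll ends a₂ {u}))) := by
  unfold EQb3 PDb EQ3
  rw [gap_eq_Q p ends u a₂ b, Qsplit_univ p ends u a₂ c, Qsplit p ends u a₂ c (connEvent ends a₂ b),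
    Qsplit p ends u a₂ c (connEvent ends u b), prob_univ]
  linear_combination (2 - 2 * prob p (avoidAll ends a₂ {c})) * s6 + 2 * prob p (avoidAll ends a₂ {c}) * s7 - 2 * prob p (avoidAll ends a₂ {c}) * s8 + (2 * prob p (avoidAll ends a₂ {c}) - 2) * s2 + (2 - 2 * prob p (avoidAll ends a₂ {c})) * s5 + 2 * prob p (avoidAll ends a₂ {c}) * s9

omit [Fintype V] in
/-- **`0 ≤ Λ`** from the share on `Q` and Harris: `N·hb·P(Q) ≥ N·P(Q, b ∈ K) = ρ_K·P(Q)`. -/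
theorem Lam_nonneg (hp : IsProbVec p) (hN : 0 ≤ N) (hρL : 0 ≤ ρL)
    (sQ : N * prob p (avoidAll ends a₂ {u} ∩ connEvent ends a₂ b) = ρK * prob p (avoidAll ends a₂ {u})) :
    0 ≤ (prob p (PDEvent ends u a₂ c) + prob p (TEvent ends a₂ u c)) * (N * prob p (connEvent ends a₂ b) - ρK) + ρL * ((prob p (PDEvent ends u a₂ c) + prob p (TEvent ends a₂ u c)) - prob p (avoidAll ends a₂ {c}) * prob p (avoidAll ends a₂ {u})) := by
  have hP0 : 0 ≤ prob p (PDEvent ends u a₂ c) + prob p (TEvent ends a₂ u c) :=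
    add_nonneg (prob_nonneg hp _) (prob_nonneg hp _)
  -- Harris for the decreasing events `{u ∉ K}`, `{c ∉ K}`: `P₀ ≥ d0·Z`
  have hH : prob p (avoidAll ends a₂ {c}) * prob p (avoidAll ends a₂ {u}) ≤
      prob p (PDEvent ends u a₂ c) + prob p (TEvent ends a₂ u c) := by
    rw [MixK.P0_eq, avoidAll_singleton_eq ends a₂ c, avoidAll_singleton_eq ends a₂ u, mul_comm]
    exact prob_mul_prob_le_prob_inter_of_isLowerSet hp (isUpperSet_connEvent ends a₂ u).compl
      (isUpperSet_connEvent ends a₂ c).compl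
  -- `P₀ ≤ Z`
  have hPZ : prob p (PDEvent ends u a₂ c) + prob p (TEvent ends a₂ u c) ≤ prob p (avoidAll ends a₂ {u}) := by
    rw [Qsplit_univ p ends u a₂ c]
    linarith [prob_nonneg hp (TEvent ends u a₂ c)]
  -- Harris for the decreasing `Q` and the increasing `{b ∈ K}`: `P(Q, bK) ≤ P(Q)·hb`
  have hQK : prob p (avoidAll ends a₂ {u} ∩ connEvent ends a₂ b) ≤
      prob p (avoidAll ends a₂ {u}) * prob p (connEvent ends a₂ b) := by
    rw [avoidAll_singleton_eq ends a₂ u]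
    exact prob_inter_le_prob_mul_prob_of_isLowerSet hp (isUpperSet_connEvent ends a₂ u).compl
      (isUpperSet_connEvent ends a₂ b)
  have hZ0 := prob_nonneg hp (avoidAll ends a₂ {u})
  -- `(N·hb − ρ_K)·Z ≥ 0`
  have hkey : 0 ≤ (N * prob p (connEvent ends a₂ b) - ρK) * prob p (avoidAll ends a₂ {u}) := by
    nlinarith [mul_le_mul_of_nonneg_left hQK hN]
  rcases hZ0.lt_or_eq with hZpos | hZzero
  · have hA : 0 ≤ N * prob p (connEvent ends a₂ b) - ρK :=
      nonneg_of_mul_nonneg_left hkey hZpos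
    nlinarith [mul_nonneg hP0 hA, mul_nonneg hρL (sub_nonneg.2 hH)]
  · have hP0z : prob p (PDEvent ends u a₂ c) + prob p (TEvent ends a₂ u c) = 0 := by
      rw [← hZzero] at hPZ
      linarith
    rw [hP0z, ← hZzero]
    simp

/-- **(MIX-K) from the shares**: `0 ≤ A·ℋ′ + 2β·X_b` — the hypothesis of `MixK.T2oK_nonneg_of_mixK`. -/
theorem mixK_of_shares (hp : IsProbVec p) (hN : 0 ≤ N) (hρL : 0 ≤ ρL)
    (sQ : N * prob p (avoidAll ends a₂ {u} ∩ connEvent ends a₂ b) = ρK * prob p (avoidAll ends a₂ {u}))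
    (s1 : N * prob p (TEvent ends a₂ u c ∩ (connEvent ends a₂ o ∩ connEvent ends a₂ b)) = ρK * prob p (TEvent ends a₂ u c ∩ connEvent ends a₂ o))
    (s2 : N * prob p (TEvent ends a₂ u c ∩ connEvent ends a₂ b) = ρK * prob p (TEvent ends a₂ u c))
    (s3 : N * prob p (PDEvent ends u a₂ c ∩ (connEvent ends a₂ o ∩ connEvent ends u b)) = ρL * prob p (PDEvent ends u a₂ c ∩ connEvent ends a₂ o))
    (s4 : N * prob p (TEvent ends a₂ u c ∩ (connEvent ends a₂ o ∩ connEvent ends u b)) = ρL * prob p (TEvent ends a₂ u c ∩ connEvent ends a₂ o))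
    (s5 : N * prob p (PDEvent ends u a₂ c ∩ connEvent ends u b) = ρL * prob p (PDEvent ends u a₂ c))
    (s6 : N * prob p (TEvent ends a₂ u c ∩ connEvent ends u b) = ρL * prob p (TEvent ends a₂ u c))
    (s7 : N * prob p (TEvent ends u a₂ c ∩ connEvent ends a₂ b) = ρK * prob p (TEvent ends u a₂ c))
    (s8 : N * prob p (TEvent ends u a₂ c ∩ connEvent ends u b) = ρL * prob p (TEvent ends u a₂ c))
    (s9 : N * prob p (PDEvent ends u a₂ c ∩ connEvent ends a₂ b) = ρK * prob p (PDEvent ends u a₂ c))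
    (hN0 : N = 0 → prob p (PDEvent ends u a₂ c) + prob p (TEvent ends a₂ u c) = 0) :
    0 ≤ ((prob p (PDEvent ends u a₂ c) * prob p (connEvent ends a₂ b) + prob p (avoidAll ends a₂ {c}) * gap p ends u a₂ b) + (prob p Set.univ * EQb3 p ends u a₂ c b + prob p Set.univ * PDb p ends u a₂ c b + prob p (connEvent ends a₂ b) * EQ3 p ends u a₂ c + prob p (connEvent ends a₂ b) * prob p (avoidAll ends a₂ {u}) - (prob p Set.univ - prob p (avoidAll ends a₂ {c})) * gap p ends u a₂ b)) * (prob p (TEvent ends a₂ u c) * prob p (PDEvent ends u a₂ c ∩ connEvent ends a₂ o) - prob p (PDEvent ends u a₂ c) * prob p (TEvent ends a₂ u c ∩ connEvent ends a₂ o)) + 2 * (prob p Set.univ * prob p (PDEvent ends u a₂ c) + prob p (avoidAll ends a₂ {c}) * prob p (avoidAll ends a₂ {u})) * (prob p (TEvent ends a₂ u c ∩ (connEvent ends a₂ o ∩ connEvent ends a₂ b)) * (prob p (PDEvent ends u a₂ c) + prob p (TEvent ends a₂ u c)) - prob p (TEvent ends a₂ u c ∩ connEvent ends a₂ b) * (prob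 p (PDEvent ends u a₂ c ∩ connEvent ends a₂ o) + prob p (TEvent ends a₂ u c ∩ connEvent ends a₂ o)) - (prob p (PDEvent ends u a₂ c ∩ (connEvent ends a₂ o ∩ connEvent ends u b)) + prob p (TEvent ends a₂ u c ∩ (connEvent ends a₂ o ∩ connEvent ends u b))) * (prob p (PDEvent ends u a₂ c) + prob p (TEvent ends a₂ u c)) + (prob p (PDEvent ends u a₂ c ∩ connEvent ends u b) + prob p (TEvent ends a₂ u c ∩ connEvent ends u b)) * (prob p (PDEvent ends u a₂ c ∩ connEvent ends a₂ o) + prob p (TEvent ends a₂ u c ∩ connEvent ends a₂ o))) := by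
  have hX := N_Xb_eq p ends o a₂ c b u N ρK ρL s1 s2 s3 s4 s5 s6
  have hA := NA_sub_eq p ends a₂ c b u N ρK ρL s2 s5 s6 s7 s8 s9
  have hL := Lam_nonneg p ends a₂ c b u N ρK ρL hp hN hρL sQ
  have hH := MixK.HoK_nonneg p ends o a₂ c u hp
  rcases hN.lt_or_eq with hpos | hzero
  · -- `N > 0`: `N·(A·ℋ′ + 2β·X_b) = 2·ℋ′·Λ ≥ 0`
    have key : N * (((prob p (PDEvent ends u a₂ c) * prob p (connEvent ends a₂ b) + prob p (avoidAll ends a₂ {c}) * gap p ends u a₂ b) + (prob p Set.univ * EQb3 p ends u a₂ c b + prob p Set.univ * PDb p ends u a₂ c b + prob p (connEvent ends a₂ b) * EQ3 p ends u a₂ c + prob p (connEvent ends a₂ b) * prob p (avoidAll ends a₂ {u}) - (prob p Set.univ - prob p (avoidAll ends a₂ {c})) * gap p ends u a₂ b)) * (prob p (TEvent ends a₂ u c) * prob p (PDEvent ends u a₂ c ∩ connEvent ends a₂ o) - prob p (PDEvent ends u a₂ c) * prob p (TEvent ends a₂ u c ∩ connEvent ends a₂ o)) + 2 * (prob p Set.univ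 * prob p (PDEvent ends u a₂ c) + prob p (avoidAll ends a₂ {c}) * prob p (avoidAll ends a₂ {u})) * (prob p (TEvent ends a₂ u c ∩ (connEvent ends a₂ o ∩ connEvent ends a₂ b)) * (prob p (PDEvent ends u a₂ c) + prob p (TEvent ends a₂ u c)) - prob p (TEvent ends a₂ u c ∩ connEvent ends a₂ b) * (prob p (PDEvent ends u a₂ c ∩ connEvent ends a₂ o) + prob p (TEvent ends a₂ u c ∩ connEvent ends a₂ o)) - (prob p (PDEvent ends u a₂ c ∩ (connEvent ends a₂ o ∩ connEvent ends u b)) + prob p (TEvent ends a₂ u c ∩ (connEvent ends a₂ o ∩ connEvent ends u b))) * (prob p (PDEvent ends u a₂ c) + prob p (TEvent ends a₂ u c)) + (prob p (PDEvent ends u a₂ c ∩ connEvent ends u b) + prob p (TEvent ends a₂ u c ∩ connEvent ends u b)) * (prob p (PDEvent ends u a₂ c ∩ connEvent ends a₂ o) + prob p (TEvent ends a₂ u c ∩ connEvent ends a₂ o)))) =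
        2 * (prob p (TEvent ends a₂ u c) * prob p (PDEvent ends u a₂ c ∩ connEvent ends a₂ o) - prob p (PDEvent ends u a₂ c) * prob p (TEvent ends a₂ u c ∩ connEvent ends a₂ o)) * ((prob p (PDEvent ends u a₂ c) + prob p (TEvent ends a₂ u c)) * (N * prob p (connEvent ends a₂ b) - ρK) + ρL * ((prob p (PDEvent ends u a₂ c) + prob p (TEvent ends a₂ u c)) - prob p (avoidAll ends a₂ {c}) * prob p (avoidAll ends a₂ {u}))) := by
      linear_combination (prob p (TEvent ends a₂ u c) * prob p (PDEvent ends u a₂ c ∩ connEvent ends a₂ o) - prob p (PDEvent ends u a₂ c) * prob p (TEvent ends a₂ u c ∩ connEvent ends a₂ o)) * hA + 2 * (prob p Set.univ * prob p (PDEvent ends u a₂ c) + prob p (avoidAll ends a₂ {c}) * prob p (avoidAll ends a₂ {u})) * hX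
    have hR : 0 ≤ 2 * (prob p (TEvent ends a₂ u c) * prob p (PDEvent ends u a₂ c ∩ connEvent ends a₂ o) - prob p (PDEvent ends u a₂ c) * prob p (TEvent ends a₂ u c ∩ connEvent ends a₂ o)) * ((prob p (PDEvent ends u a₂ c) + prob p (TEvent ends a₂ u c)) * (N * prob p (connEvent ends a₂ b) - ρK) + ρL * ((prob p (PDEvent ends u a₂ c) + prob p (TEvent ends a₂ u c)) - prob p (avoidAll ends a₂ {c}) * prob p (avoidAll ends a₂ {u}))) :=
      mul_nonneg (mul_nonneg zero_le_two hH) hL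
    rw [← key] at hR
    exact (mul_nonneg_iff_of_pos_left hpos).1 hR
  · -- `N = 0`: every `PD`/`T′` mass vanishes
    have h0 := hN0 hzero.symm
    have z := MixK.prob_PD_eq_zero_of_P0 p ends a₂ c u hp h0
    have hD := (z Set.univ).1
    have hT := (z Set.univ).2
    simp only [Set.inter_univ] at hD hT
    rw [(z (connEvent ends a₂ o)).1, (z (connEvent ends a₂ o)).2,
      (z (connEvent ends a₂ o ∩ connEvent ends a₂ b)).2, (z (connEvent ends a₂ b)).2,
      (z (connEvent ends a₂ o ∩ connEvent ends u b)).1, (z (connEvent ends a₂ o ∩ connEvent ends u b)).2,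
      (z (connEvent ends u b)).1, (z (connEvent ends u b)).2, hD, hT]
    simp

/-- **`0 ≤ T2oK` from the shares.** -/
theorem T2oK_nonneg_of_shares (hp : IsProbVec p) (hN : 0 ≤ N) (hρL : 0 ≤ ρL)
    (sQ : N * prob p (avoidAll ends a₂ {u} ∩ connEvent ends a₂ b) = ρK * prob p (avoidAll ends a₂ {u}))
    (s1 : N * prob p (TEvent ends a₂ u c ∩ (connEvent ends a₂ o ∩ connEvent ends a₂ b)) = ρK * prob p (TEvent ends a₂ u c ∩ connEvent ends a₂ o))
    (s2 : N * prob p (TEvent ends a₂ u c ∩ connEvent ends a₂ b) = ρK * prob p (TEvent ends a₂ u c))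
    (s3 : N * prob p (PDEvent ends u a₂ c ∩ (connEvent ends a₂ o ∩ connEvent ends u b)) = ρL * prob p (PDEvent ends u a₂ c ∩ connEvent ends a₂ o))
    (s4 : N * prob p (TEvent ends a₂ u c ∩ (connEvent ends a₂ o ∩ connEvent ends u b)) = ρL * prob p (TEvent ends a₂ u c ∩ connEvent ends a₂ o))
    (s5 : N * prob p (PDEvent ends u a₂ c ∩ connEvent ends u b) = ρL * prob p (PDEvent ends u a₂ c))
    (s6 : N * prob p (TEvent ends a₂ u c ∩ connEvent ends u b) = ρL * prob p (TEvent ends a₂ u c))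
    (s7 : N * prob p (TEvent ends u a₂ c ∩ connEvent ends a₂ b) = ρK * prob p (TEvent ends u a₂ c))
    (s8 : N * prob p (TEvent ends u a₂ c ∩ connEvent ends u b) = ρL * prob p (TEvent ends u a₂ c))
    (s9 : N * prob p (PDEvent ends u a₂ c ∩ connEvent ends a₂ b) = ρK * prob p (PDEvent ends u a₂ c))
    (hN0 : N = 0 → prob p (PDEvent ends u a₂ c) + prob p (TEvent ends a₂ u c) = 0) :
    0 ≤ T2oK p ends o a₂ c b u :=
  MixK.T2oK_nonneg_of_mixK p ends o a₂ c b u hp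
    (mixK_of_shares p ends o a₂ c b u N ρK ρL hp hN hρL sQ s1 s2 s3 s4 s5 s6 s7 s8 s9 hN0)

end KSide

end Share

end RootLeafU

end Summit.Ventures.PercRepro2
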